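import Literature.Computability.QuantumComplexity.ForrelationDerivativeTables
import HarnessLib

/-!
# The square of the 3-fold forrelation through derivative Walsh tables

Topic `Literature/Computability/QuantumComplexity` (family `quantum-advantage`; written by the refuter seat
`refuter-cdisprove-stmt-QuantumAdvantage-2204-g2-0`, 2026-08-15, as machine-checked groundwork for the
k = 3 rung announced by route `QuantumAdvantage/CubicForrelation` — "tenure restates at k = 3:
`cubicKForrelationProblem 3` … where the Φ² lever has variance 2ⁿ"). Sequel to
`ForrelationDerivativeTables.lean` (k = 2: `∑_{h,u} T_f(h,u) T_g(u,h) = S(f,g)²`). EVERYTHING here is a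
theorem (no named facts).

With `W_f(y) = ∑_x f(x)(-1)^{x·y}` and the derivative Walsh table `T_f(h,u) = ∑_x f(x) f(x⊕h) (-1)^{u·x}`
(`DerivativeWalsh.W`, `DerivativeWalsh.dwt`), the unnormalised 3-fold forrelation sum is
`S₃(f,g,h) = ∑_{x,y,z} f(x)(-1)^{x·y} g(y) (-1)^{y·z} h(z) = ∑_y g(y) W_f(y) W_h(y)` and

* `W_mul_W_bxor` : `W_f(y) · W_f(y ⊕ t) = ∑_s (-1)^{s·y} T_f(s,t)` (product of two Walsh values =
  twisted table column; a repackaging of the tree's `sum_twist_mul_dwt`);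
* `sum_mul_W_mul_W_sq` : **`S₃² = ∑_{t,s,s'} T_f(s,t) · T_h(s',t) · T_g(t, s ⊕ s')`** for ALL real
  `f, g, h` (reindex `y' = y ⊕ t`, apply `W_mul_W_bxor` twice, recognise `T_g(t, s⊕s')`);
* `kForrelationValue_fin_three` : the tree's `kForrelationValue` at `k = 3` is
  `2^{-2n} ∑_{x,y,z} f₀(x)(-1)^{x·y} f₁(y)(-1)^{y·z} f₂(z)`, and `two_pow_mul_kForrelationValue_three_sq` :
  `2^{4n} Φ₃² = ∑_{t,s,s'} T_{f₀}(s,t) T_{f₂}(s',t) T_{f₁}(t, s⊕s')` for Boolean data read through `signOf`.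

## Why it matters (prose)

For CUBIC phase functions every table entry is still an exact quadratic Gauss sum, so `Φ₃²` is again a
signed sum of products of polynomial-time computable integers — but now a TRIPLE product over `2^{3n}`
index triples, pairing a column of `T_{f₀}`, a column of `T_{f₂}` (same column index `t`) and a row
of `T_{f₁}`. The k = 2 length-squared sampler (`(h,u) ∝ T_f(h,u)²`, row mass exactly `4ⁿ`) has no
evident analogue with bounded relative variance: the column masses `∑_s T_f(s,t)²` are NOT constant in
`t` (they are the Walsh transform of the squared autocorrelation of `f`), so neither the sampling law
nor an `O(1)` second-moment bound comes for free. This file records the identity only; it makes no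
complexity claim about `cubicKForrelationProblem 3`.

## References

* [AaronsonAmbainis2018] S. Aaronson, A. Ambainis, Forrelation, SIAM J. Comput. 47 (2018), §1.1.3
  (`k`-fold forrelation), §6 Thm 25–26 (cubic instances, `k = poly`).
* [ODonnell2014] R. O'Donnell, Analysis of Boolean Functions (2014), §1.4 (characters, Parseval).
-/

noncomputable section

namespace Literature.Computability.QuantumComplexity

namespace DerivativeWalsh

open Finset
open Literature.Computability.QuantumComplexity.BuzetChailloux
open Literature.Computability.QuantumComplexity.Simon (twist_xor_left)

variable {n : ℕ}

/-! ### Products of Walsh values -/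

/-- `W_f(y ⊕ t) = ∑_x f(x) (-1)^{x·y} (-1)^{t·x}`. [cite: ODonnell2014, §1.4] -/
theorem W_bxor (f : (Fin n → Bool) → ℝ) (y t : Fin n → Bool) :
    W f (bxor y t) = ∑ x, f x * twist x y * twist t x := by
  unfold W
  refine sum_congr rfl fun x _ => ?_
  rw [twist_bxor_right, twist_comm t x]
  ring

/-- **Product of two Walsh values = twisted derivative-table column**:
`W_f(y) · W_f(y ⊕ t) = ∑_s (-1)^{s·y} T_f(s,t)`. [folklore] -/
theorem W_mul_W_bxor (f : (Fin n → Bool) → ℝ) (y t : Fin n → Bool) :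
    W f y * W f (bxor y t) = ∑ s, twist s y * dwt f s t := by
  rw [sum_twist_mul_dwt, W_bxor]

/-! ### The 3-fold identity -/

/-- **The 3-fold analogue of the dequantization identity.** For ALL real `f g h : {0,1}ⁿ → ℝ`,
`(∑_y g(y) W_f(y) W_h(y))² = ∑_{t,s,s'} T_f(s,t) · T_h(s',t) · T_g(t, s ⊕ s')`: the square of the
unnormalised 3-fold forrelation sum is a sum of TRIPLE products of derivative-Walsh-table entries
(two columns with the same index `t` and one row). [folklore] -/
theorem sum_mul_W_mul_W_sq (f g h : (Fin n → Bool) → ℝ) :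
    (∑ y, g y * W f y * W h y) ^ 2 =
      ∑ t, ∑ s, ∑ s', dwt f s t * dwt h s' t * dwt g t (bxor s s') := by
  -- expand the square and reindex the second variable as `y ⊕ t`
  have e1 : (∑ y, g y * W f y * W h y) ^ 2 =
      ∑ y, ∑ t, (g y * W f y * W h y) * (g (bxor y t) * W f (bxor y t) * W h (bxor y t)) := by
    rw [sq, sum_mul_sum]
    refine sum_congr rfl fun y _ => ?_
    rw [← Equiv.sum_comp (bxorPerm y) (fun y' => (g y * W f y * W h y) * (g y' * W f y' * W h y'))]
    rfl
  -- each summand through the two product formulas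
  have e2 : ∀ y t : Fin n → Bool,
      (g y * W f y * W h y) * (g (bxor y t) * W f (bxor y t) * W h (bxor y t)) =
        ∑ s, ∑ s', dwt f s t * dwt h s' t * (g y * g (bxor y t) * twist (bxor s s') y) := by
    intro y t
    have hf := W_mul_W_bxor f y t
    have hh := W_mul_W_bxor h y t
    calc (g y * W f y * W h y) * (g (bxor y t) * W f (bxor y t) * W h (bxor y t))
        = g y * g (bxor y t) * ((W f y * W f (bxor y t)) * (W h y * W h (bxor y t))) := by ring
      _ = g y * g (bxor y t) * ((∑ s, twist s y * dwt f s t) * (∑ s', twist s' y * dwt h s' t)) := by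
          rw [hf, hh]
      _ = ∑ s, ∑ s', dwt f s t * dwt h s' t * (g y * g (bxor y t) * twist (bxor s s') y) := by
          rw [sum_mul_sum, mul_sum]
          refine sum_congr rfl fun s _ => ?_
          rw [mul_sum]
          refine sum_congr rfl fun s' _ => ?_
          rw [show bxor s s' = fun i => s i ^^ s' i from rfl, twist_xor_left]
          ring
  rw [e1, sum_congr rfl fun y _ => sum_congr rfl fun t _ => e2 y t, sum_comm]
  refine sum_congr rfl fun t _ => ?_
  rw [sum_comm]
  refine sum_congr rfl fun s _ => ?_
  rw [sum_comm]
  refine sum_congr rfl fun s' _ => ?_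
  rw [← mul_sum]
  rfl

/-! ### Over the tree's `kForrelationValue` at `k = 3` -/

/-- The `k = 3` unfolding of the tree's `kForrelationValue`:
`Φ_{f₀,f₁,f₂} = 2^{-2n} ∑_{x,y,z} f₀(x) (-1)^{x·y} f₁(y) (-1)^{y·z} f₂(z)`.
[cite: AaronsonAmbainis2018, §1.1.3] -/
theorem kForrelationValue_fin_three (F : Fin 3 → (Fin n → Bool) → Bool) :
    kForrelationValue F = (Real.sqrt (2 ^ (4 * n)))⁻¹ *
      ∑ x, ∑ y, ∑ z, signOf (F 0 x) * twist x y * signOf (F 1 y) * twist y z * signOf (F 2 z) := by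
  unfold kForrelationValue
  rw [show ((3 + 1) * n) = 4 * n by ring]
  congr 1
  rw [← (Fin.consEquiv fun _ : Fin 3 => Fin n → Bool).sum_comp, Fintype.sum_prod_type]
  refine sum_congr rfl fun x _ => ?_
  rw [← (piFinTwoEquiv fun _ : Fin 2 => Fin n → Bool).symm.sum_comp, Fintype.sum_prod_type]
  refine sum_congr rfl fun y _ => sum_congr rfl fun z _ => ?_
  rw [Fin.prod_univ_three]
  simp [piFinTwoEquiv, Fin.consEquiv]
  rw [show (Fin.cons x (Fin.cons y (Fin.cons z finZeroElim)) : Fin 3 → (Fin n → Bool)) 2 = z from rfl]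
  ring

/-- The triple sum is `∑_y f₁(y) W_{f₀}(y) W_{f₂}(y)`. [cite: AaronsonAmbainis2018, §1.1.3] -/
theorem sum_three_eq_sum_mul_W_mul_W (f₀ f₁ f₂ : (Fin n → Bool) → ℝ) :
    ∑ x, ∑ y, ∑ z, f₀ x * twist x y * f₁ y * twist y z * f₂ z = ∑ y, f₁ y * W f₀ y * W f₂ y := by
  rw [sum_comm]
  refine sum_congr rfl fun y _ => ?_
  have e : ∀ x : Fin n → Bool, ∑ z, f₀ x * twist x y * f₁ y * twist y z * f₂ z =
      f₀ x * twist x y * (f₁ y * W f₂ y) := by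
    intro x
    rw [W, mul_sum, mul_sum]
    refine sum_congr rfl fun z _ => ?_
    rw [twist_comm y z]
    ring
  rw [sum_congr rfl fun x _ => e x, ← sum_mul]
  rw [show (∑ x, f₀ x * twist x y) = W f₀ y from rfl]
  ring

/-- **`2^{4n} · Φ₃² = ∑_{t,s,s'} T_{f₀}(s,t) T_{f₂}(s',t) T_{f₁}(t, s ⊕ s')`** for the tree's 3-fold
`kForrelationValue` of Boolean data read through `signOf`. [cite: AaronsonAmbainis2018, §1.1.3] -/
theorem two_pow_mul_kForrelationValue_three_sq (F : Fin 3 → (Fin n → Bool) → Bool) :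
    (2 : ℝ) ^ (4 * n) * kForrelationValue F ^ 2 =
      ∑ t, ∑ s, ∑ s', dwt (fun x => signOf (F 0 x)) s t * dwt (fun z => signOf (F 2 z)) s' t *
        dwt (fun y => signOf (F 1 y)) t (bxor s s') := by
  rw [kForrelationValue_fin_three, sum_three_eq_sum_mul_W_mul_W, mul_pow, inv_pow,
    Real.sq_sqrt (by positivity), ← sum_mul_W_mul_W_sq]
  field_simp

end DerivativeWalsh

end Literature.Computability.QuantumComplexity

end
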